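import Summits.NavierStokesRegularity.NavierStokesRegularity.Theorems.SymmetryModuliCountSymmetricLiouville
import Summits.NavierStokesRegularity.NavierStokesRegularity.Theorems.SymmetryModuliCountAxisymEndLiouville
import Summits.NavierStokesRegularity.NavierStokesRegularity.Theorems.TypeIDSSLiouvilleConjecture
import Summits.NavierStokesRegularity.NavierStokesRegularity.Theorems.SymmetryModuliCountSymmetricLiouvilleAncientOseenBound
import Summits.NavierStokesRegularity.NavierStokesRegularity.Theorems.SymmetryModuliCountSymmetricLiouvilleKernelTimeWeightIntegral
import Summits.NavierStokesRegularity.NavierStokesRegularity.Theorems.SymmetryModuliCountSymmetricLiouvilleSlabKernelBound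
import Summits.NavierStokesRegularity.NavierStokesRegularity.Theorems.SymmetryModuliCountSymmetricLiouvilleCrossingTimeIntegral
import Summits.NavierStokesRegularity.NavierStokesRegularity.Theorems.SymmetryModuliCountSymmetricLiouvilleEnvelopeDecay
import Summits.NavierStokesRegularity.NavierStokesRegularity.Theorems.SymmetryModuliCountSymmetricLiouvilleOseenBootstrapOf
import Summits.NavierStokesRegularity.NavierStokesRegularity.Theorems.SymmetryModuliCountSymmetricLiouvilleRssCoreOfConjecture
import Literature.Analysis.FluidPDE.TypeIAncientMild
import HarnessLib

/-!
# Skeleton (lead c1 reshape) of line `blowdown-kills-pitch` for crux `SymmetricLiouville`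
# (stmt-NavierStokesRegularity-4053, route `SymmetryModuliCount`)

State of the line. Six of the seven stubs of the previous reshape (`Lines/blowdown_kills_pitch.lean`) are LANDED
tree theorems and the assembly `Theorems/SymmetryModuliCountSymmetricLiouville.lean` proves
`symmetricLiouville_of_core : core → AxisymEndLiouville → SymmetricLiouville`; the route item `AxisymEndLiouville`
(stmt-14061) is now the tree theorem `Theorems.AxisymEndLiouville_of`. Hence the crux is EQUIVALENT to the one
remaining stub `stub_rssLiouvilleOfFarField` (5b″: rotated-self-similar elements of `A_C`, `A ≠ 0` skew, profile
`→ 0` at infinity, vanish) — `symmetricLiouville_iff_core` below, sorry-free.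

This reshape cuts 5b″ along its provable / conjectural seam:

* **B2, the symmetry-free Oseen bootstrap** `Sig.OseenBootstrap` (verbatim the statement `stub_oseenBootstrap` filed
  by the planners of lines `farfield-recentring-critical-rate` and `degenerate-stabiliser-zoom`): `u ∈ A_C` whose
  scale-invariant size `√(−t)‖u‖` is small outside paraboloids `‖x‖ ≥ R√(−t)` obeys the space–time Type-I bound
  `‖u(t,x)‖ ≤ K/(‖x‖ + √(−t))` (`HasTypeIDecay K u`, Pineau–Vicol's class (1.10)). Proof = ancient Oseen inequality
  `‖u(t,x)‖ ≤ C₀ ∫_{τ<t}∫ (t−τ+‖x−y‖²)^{-2}‖u(τ,y)‖² dy dτ` (stub T1) + an envelope argument on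
  `m(L) := sup{√(−t)‖u(t,x)‖ : ‖x‖ ≥ L√(−t)}` : the sources with `|y·x̂| > (L/4)√(−τ)` are bounded by `m(L/4)²/(−τ)`
  and radiate `≤ A m(L/4)²/√(−t)` (stub T2); the slab `|y·x̂| ≤ (L/4)√(−τ)` is integrated first over the plane
  `⊥ x̂` (`∫_{ℝ²}(a + |y'|²)^{-2}dy' = π/a`, stub T3), then in time across the crossing of each sheet `y·x̂ = ρ√(−τ)`
  (`∫ s^{-1/2}(s − s₀ + (‖x‖ − ρ√s)²)^{-1} ds ≤ A/‖x‖` for `|ρ| ≤ L/4`, stub T4), giving the MASTER INEQUALITY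
  `m(L) ≤ A₁ m(L/4)² + (A₂/L)∫₀^{L/4} m²` with no logarithm; `m → 0` then forces `m(L) ≤ K/L` (stub T5, a discrete
  dyadic induction: rate `L^{-3/4}` first, which makes `m ∈ L²`, then `L^{-1}`). The integration (Tonelli, the
  substitution `y·x̂ = ρ√(−τ)`, the envelope bookkeeping) is the lead's stub T6 `stub_oseenBootstrap_of`.
* **The bridge to the canonical conjecture** (stub T7 `stub_rssCoreOfConjecture`): an element of `A_C` which is
  EXACTLY rotated self-similar (`∇u·(x + Ax) + u + 2t∂ₜu − Au = 0`, integrated along the group by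
  `rss_pull_const`) is rotated `λ`-DSS for every `λ = e^ρ > 1` with rotation `e^{ρA}`; it is an ancient mild solution
  in the duality sense (`IsTypeIAncientMild.isAncientMildSolution`) with continuous slices; so under
  `TypeIDSSLiouvilleConjecture` (leaf `Theorems/TypeIDSSLiouvilleConjecture.lean` = Bradshaw–Tsai OP 5.1 / Tsai GSM 192
  Conj. 8.8–8.9, the `R`-rotated half) and the Type-I space–time bound it vanishes a.e., hence everywhere.

Composition: `SymmetricLiouville_of : T1 → T2 → T3 → T4 → T5 → T6 → T7 → TypeIDSSLiouvilleConjecture → Sig.Crux`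
(sorry-free; every stub LANDED, so the file has no `sorry`), i.e. the line closes the crux MODULO the canonical open conjecture, which is the honest terminal state of
this conjecture-grade crux (the crux implies 5b″, which contains Pineau–Vicol Conj. 1.1; the window `α ≈ 1` is open).
-/

noncomputable section

set_option linter.dupNamespace false

open Set Function Filter MeasureTheory
open scoped Topology ENNReal
open Literature.Analysis.FluidPDE
open Summit.NavierStokesRegularity.NavierStokesRegularity.Theses.SymmetryModuliCount

namespace Summit.NavierStokesRegularity.NavierStokesRegularity.Theorems.SymmetryModuliCountSymmetricLiouville

/-- Local notation for physical space `ℝ³`. -/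
local notation "E3" => EuclideanSpace ℝ (Fin 3)

/-! ## Statements (`Sig.*`) -/

/-- The crux decl, wrapped (`Iff.rfl`-transparent). -/
def Sig.Crux : Prop := SymmetricLiouville

/-- **The open core 5b″** (registered stub of the previous reshape, kept verbatim as the glue target): RSS elements
of `A_C` with `A ≠ 0` whose scale-invariant size is small far from the centre vanish. -/
def Sig.Core : Prop :=
  ∀ (C : ℝ) (u : ℝ → E3 → E3), IsTypeIAncientMild C u →
    ∀ A : E3 →L[ℝ] E3, (∀ x, inner ℝ (A x) x = 0) → A ≠ 0 →
      (∀ t < 0, ∀ x, fderiv ℝ (u t) x (x + A x) + u t x + (2 * t) • timeDeriv u t x - A (u t x) = 0) →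
      (∀ ε > 0, ∃ R : ℝ, ∀ t < 0, ∀ x, R * Real.sqrt (-t) ≤ ‖x‖ → Real.sqrt (-t) * ‖u t x‖ ≤ ε) →
      ∀ t < 0, ∀ x, u t x = 0

/-- **B2, the symmetry-free Oseen bootstrap** (statement identical to the planners' `stub_oseenBootstrap`). -/
def Sig.OseenBootstrap : Prop :=
  ∀ (C : ℝ) (u : ℝ → E3 → E3), IsTypeIAncientMild C u →
    (∀ ε > 0, ∃ R : ℝ, ∀ t < 0, ∀ x, R * Real.sqrt (-t) ≤ ‖x‖ → Real.sqrt (-t) * ‖u t x‖ ≤ ε) →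
    ∃ K : ℝ, HasTypeIDecay K u

/-- **RSS Liouville in Pineau–Vicol's class inside `A_C`** (= PV Conj. 1.1 in the gauge; the conjectural half). -/
def Sig.CoreTypeI : Prop :=
  ∀ (C : ℝ) (u : ℝ → E3 → E3), IsTypeIAncientMild C u →
    ∀ A : E3 →L[ℝ] E3, (∀ x, inner ℝ (A x) x = 0) → A ≠ 0 →
      (∀ t < 0, ∀ x, fderiv ℝ (u t) x (x + A x) + u t x + (2 * t) • timeDeriv u t x - A (u t x) = 0) →
      (∃ K : ℝ, HasTypeIDecay K u) → ∀ t < 0, ∀ x, u t x = 0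

/-- T1 (statement): the ancient Oseen inequality. -/
def Sig.stub_ancientOseenBound : Prop :=
  ∃ C₀ : ℝ, 0 < C₀ ∧ ∀ (C : ℝ) (u : ℝ → E3 → E3), IsTypeIAncientMild C u → ∀ t < 0, ∀ x : E3,
    ENNReal.ofReal ‖u t x‖ ≤ ENNReal.ofReal C₀ *
      ∫⁻ τ in Set.Iio t, ∫⁻ y, ENNReal.ofReal ((t - τ + ‖x - y‖ ^ 2)⁻¹ ^ 2 * ‖u τ y‖ ^ 2)

/-- T2 (statement): the kernel against the temporal Type-I weight. -/
def Sig.stub_kernelTimeWeightIntegral : Prop :=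
  ∃ A : ℝ, 0 < A ∧ ∀ t < 0, ∀ x : E3,
    ∫⁻ τ in Set.Iio t, ∫⁻ y, ENNReal.ofReal ((t - τ + ‖x - y‖ ^ 2)⁻¹ ^ 2 * (-τ)⁻¹) ≤
      ENNReal.ofReal (A / Real.sqrt (-t))

/-- T3 (statement): the slab / Fubini bound (integrate the kernel over the plane orthogonal to `x̂` first). -/
def Sig.stub_slabKernelBound : Prop :=
  ∃ A : ℝ, 0 < A ∧ ∀ x : E3, x ≠ 0 → ∀ σ : ℝ, 0 < σ → ∀ (a : ℝ) (F : ℝ → ℝ≥0∞), Measurable F →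
    ∫⁻ y in {y : E3 | |inner ℝ y x| ≤ a * ‖x‖},
        ENNReal.ofReal ((σ + ‖x - y‖ ^ 2)⁻¹ ^ 2) * F (inner ℝ y x / ‖x‖) ≤
      ENNReal.ofReal A * ∫⁻ r in Set.Icc (-a) a, ENNReal.ofReal ((σ + (‖x‖ - r) ^ 2)⁻¹) * F r

/-- T4 (statement): the crossing-time integral of one sheet. -/
def Sig.stub_crossingTimeIntegral : Prop :=
  ∃ A : ℝ, 0 < A ∧ ∀ s₀ : ℝ, 0 < s₀ → ∀ X : ℝ, 0 < X → ∀ ρ : ℝ, |ρ| * (4 * Real.sqrt s₀) ≤ X →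
    ∫⁻ s in Set.Ioi s₀, ENNReal.ofReal ((Real.sqrt s)⁻¹ * (s - s₀ + (X - ρ * Real.sqrt s) ^ 2)⁻¹) ≤
      ENNReal.ofReal (A / X)

/-- T5 (statement): the envelope functional inequality forces the critical rate. -/
def Sig.stub_envelopeDecay : Prop :=
  ∀ (m : ℝ → ℝ) (Cm A₁ A₂ : ℝ), Antitone m → (∀ L, 0 ≤ m L) → (∀ L, m L ≤ Cm) → 0 ≤ A₁ → 0 ≤ A₂ →
    Tendsto m atTop (𝓝 0) →
    (∀ L, 0 < L → m L ≤ A₁ * m (L / 4) ^ 2 + A₂ / L * ∫ s in (0:ℝ)..(L / 4), m s ^ 2) →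
    ∃ K : ℝ, ∀ L, 0 < L → m L ≤ K / L

/-- T7 (statement): the bridge from the canonical conjecture to the Type-I RSS core. -/
def Sig.stub_rssCoreOfConjecture : Prop :=
  _root_.Summit.NavierStokesRegularity.NavierStokesRegularity.TypeIDSSLiouvilleConjecture → Sig.CoreTypeI

/-! ## Registered stubs — ALL LANDED (tree theorems of the same names, imported above)

* T1 `stub_ancientOseenBound` — `…SymmetricLiouvilleAncientOseenBound.lean` (p99786);
* T2 `stub_kernelTimeWeightIntegral` — `…SymmetricLiouvilleKernelTimeWeightIntegral.lean` (p100127);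
* T3 `stub_slabKernelBound` — `…SymmetricLiouvilleSlabKernelBound.lean` (p100542);
* T4 `stub_crossingTimeIntegral` — `…SymmetricLiouvilleCrossingTimeIntegral.lean` (p98565);
* T5 `stub_envelopeDecay` — `…SymmetricLiouvilleEnvelopeDecay.lean` (p99609);
* T6 `stub_oseenBootstrap_of` — `…SymmetricLiouvilleOseenBootstrapTools.lean` (p100930) +
  `…SymmetricLiouvilleOseenBootstrapOf.lean` (p102893);
* T7 `stub_rssCoreOfConjecture` — `…SymmetricLiouvilleRssCoreOfConjecture.lean` (p100076).
-/

/-! ## Compositions (sorry-free) -/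

/-- B2 from the registered stubs. -/
theorem oseenBootstrap : Sig.OseenBootstrap :=
  stub_oseenBootstrap_of stub_ancientOseenBound stub_kernelTimeWeightIntegral stub_slabKernelBound
    stub_crossingTimeIntegral stub_envelopeDecay

/-- **The open core 5b″ from B2, the bridge and the canonical conjecture.** -/
theorem core_of (hB2 : Sig.OseenBootstrap) (hBr : Sig.stub_rssCoreOfConjecture)
    (hConj : _root_.Summit.NavierStokesRegularity.NavierStokesRegularity.TypeIDSSLiouvilleConjecture) :
    Sig.Core :=
  fun C u hu A hA hA0 hL hfar => hBr hConj C u hu A hA hA0 hL (hB2 C u hu hfar)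

/-- **The skeleton concludes the crux BY NAME**, modulo the registered stubs T1–T7 and the canonical conjecture
leaf `TypeIDSSLiouvilleConjecture`: `symmetricLiouville_of_core` (tree assembly of the landed stubs 1–5b′) fed
with `core_of` and the tree theorem `AxisymEndLiouville_of` (route item stmt-14061). -/
theorem SymmetricLiouville_of :
    Sig.stub_ancientOseenBound → Sig.stub_kernelTimeWeightIntegral → Sig.stub_slabKernelBound →
      Sig.stub_crossingTimeIntegral → Sig.stub_envelopeDecay →
      (Sig.stub_ancientOseenBound → Sig.stub_kernelTimeWeightIntegral → Sig.stub_slabKernelBound →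
        Sig.stub_crossingTimeIntegral → Sig.stub_envelopeDecay → Sig.OseenBootstrap) →
      Sig.stub_rssCoreOfConjecture →
      _root_.Summit.NavierStokesRegularity.NavierStokesRegularity.TypeIDSSLiouvilleConjecture → Sig.Crux :=
  fun h1 h2 h3 h4 h5 h6 h7 hConj =>
    symmetricLiouville_of_core (core_of (h6 h1 h2 h3 h4 h5) h7 hConj) AxisymEndLiouville_of

/-- The crux itself from the registered stubs, CONDITIONAL on the canonical conjecture leaf. -/
theorem SymmetricLiouville_proof
    (hConj : _root_.Summit.NavierStokesRegularity.NavierStokesRegularity.TypeIDSSLiouvilleConjecture) :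
    SymmetricLiouville :=
  SymmetricLiouville_of stub_ancientOseenBound stub_kernelTimeWeightIntegral stub_slabKernelBound
    stub_crossingTimeIntegral stub_envelopeDecay stub_oseenBootstrap_of stub_rssCoreOfConjecture hConj

/-! ## Position lemmas (sorry-free) -/

/-- **The crux is EQUIVALENT to its open core 5b″** (now that `AxisymEndLiouville` is a theorem): `→` is the
specialisation `a = 0`, `σ = 1` (far-field hypothesis discarded), `←` is `symmetricLiouville_of_core`. -/
theorem symmetricLiouville_iff_core : SymmetricLiouville ↔ Sig.Core := by
  constructor
  · intro h C u hcl A hA _ hL _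
    refine h C u (isTypeIAncientMild_iff.1 hcl) 0 1 A hA (fun hz => one_ne_zero hz.2.1) ?_
    intro t ht x
    simpa only [zero_add, one_smul, mul_one] using hL t ht x
  · intro h
    exact symmetricLiouville_of_core h AxisymEndLiouville_of

/-- The Type-I core implies the open core 5b″ once B2 holds (so 5b″ sits between PV Conj. 1.1-in-the-gauge and
the crux). -/
theorem core_of_coreTypeI (hB2 : Sig.OseenBootstrap) (h : Sig.CoreTypeI) : Sig.Core :=
  fun C u hu A hA hA0 hL hfar => h C u hu A hA hA0 hL (hB2 C u hu hfar)

end Summit.NavierStokesRegularity.NavierStokesRegularity.Theorems.SymmetryModuliCountSymmetricLiouville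

end
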